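import Mathlib

/-!
# SoloBlind — Abel summation bound for the inner Volterra sums ([O1] Lemma A, PLAN §119.12)

The inner sums of the discrete LG Volterra kernel have the shape `∑_{i<n} C i * (G i - G (i+1))` with
`G i = ∏_{l=i}^{n-1} λ_l ^ 2` (so `‖G i‖ ≤ M`, `M` close to `1` for a recessive multiplier) and a slowly varying
`C` of modulus `≈ ‖λ‖ / ‖λ - λ⁻¹‖` (by `SoloBlindDiscreteLG.amplitude_modulus_identity`).  Abel summation gives

  `∑_{i ≤ n} C i (G i - G (i+1)) = C 0 G 0 - C n G (n+1) + ∑_{1 ≤ i ≤ n} (C i - C (i-1)) G i`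

and hence the bound `(‖C 0‖ + ‖C n‖ + ∑ ‖C i - C (i-1)‖) * M` — the "(2 + total variation) / ‖λ - λ⁻¹‖" constant
of Lemma A (measured: 2.0 for `x < 0`, 1.0 for `x > 0`).
-/

namespace Summit.AnomalousDissipation.SoloBlind.AbelBound

open Finset

/-- Abel summation identity. -/
theorem abel_identity (C G : ℕ → ℂ) (n : ℕ) :
    ∑ i ∈ range (n + 1), C i * (G i - G (i + 1))
      = C 0 * G 0 - C n * G (n + 1) + ∑ i ∈ Ico 1 (n + 1), (C i - C (i - 1)) * G i := by
  induction n with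
  | zero => simp; ring
  | succ n ih =>
    rw [sum_range_succ, ih, sum_Ico_succ_top (by omega : 1 ≤ n + 1)]
    simp only [Nat.add_sub_cancel]
    ring

/-- Abel summation bound. -/
theorem abel_bound (C G : ℕ → ℂ) (n : ℕ) (M : ℝ) (hG : ∀ i, i ≤ n + 1 → ‖G i‖ ≤ M) :
    ‖∑ i ∈ range (n + 1), C i * (G i - G (i + 1))‖
      ≤ (‖C 0‖ + ‖C n‖ + ∑ i ∈ Ico 1 (n + 1), ‖C i - C (i - 1)‖) * M := by
  have hM : 0 ≤ M := (norm_nonneg _).trans (hG 0 (by omega))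
  rw [abel_identity]
  have h1 : ‖C 0 * G 0‖ ≤ ‖C 0‖ * M := by
    rw [norm_mul]; exact mul_le_mul_of_nonneg_left (hG 0 (by omega)) (norm_nonneg _)
  have h2 : ‖C n * G (n + 1)‖ ≤ ‖C n‖ * M := by
    rw [norm_mul]; exact mul_le_mul_of_nonneg_left (hG (n + 1) le_rfl) (norm_nonneg _)
  have h3 : ‖∑ i ∈ Ico 1 (n + 1), (C i - C (i - 1)) * G i‖ ≤ (∑ i ∈ Ico 1 (n + 1), ‖C i - C (i - 1)‖) * M := by
    rw [sum_mul]
    refine (norm_sum_le _ _).trans (sum_le_sum (fun i hi => ?_))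
    rw [mem_Ico] at hi
    rw [norm_mul]
    exact mul_le_mul_of_nonneg_left (hG i (by omega)) (norm_nonneg _)
  calc ‖C 0 * G 0 - C n * G (n + 1) + ∑ i ∈ Ico 1 (n + 1), (C i - C (i - 1)) * G i‖
      ≤ ‖C 0 * G 0 - C n * G (n + 1)‖ + ‖∑ i ∈ Ico 1 (n + 1), (C i - C (i - 1)) * G i‖ := norm_add_le _ _
    _ ≤ (‖C 0 * G 0‖ + ‖C n * G (n + 1)‖) + ‖∑ i ∈ Ico 1 (n + 1), (C i - C (i - 1)) * G i‖ := by
        gcongr; exact norm_sub_le _ _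
    _ ≤ (‖C 0‖ * M + ‖C n‖ * M) + (∑ i ∈ Ico 1 (n + 1), ‖C i - C (i - 1)‖) * M := by gcongr
    _ = (‖C 0‖ + ‖C n‖ + ∑ i ∈ Ico 1 (n + 1), ‖C i - C (i - 1)‖) * M := by ring

end Summit.AnomalousDissipation.SoloBlind.AbelBound
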